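import Mathlib
import HarnessLib
import Literature.Probability.MarkovChains.RandomTargetLemma

/-!
# Harmonic extension off a set `B` (Proposition 9.1): existence, uniqueness, and the two-sided maximum principle

HONEST FRAMING: exact (Metropolis-corrected) sampling algorithms for lattice gauge theory; figures
of merit are autocorrelation/cost numbers at stated couplings and volumes; no continuum-physics claim.

Source: D. A. Levin, Y. Peres (with E. L. Wilmer), *Markov Chains and Mixing Times*, 2nd ed.,
AMS 2017 [LevinPeres2017], §9.2 "Harmonic Functions", eq. (9.2) and PROPOSITION 9.1 with its proof
and Remark 9.2 (p. 117).  Conventions of `RandomTargetLemma.lean` (the maximum principle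
`harmonicOff_max_reaches` / `harmonicOff_ge_of_forall_mem` proved there for the case needed by
Lemma 10.1) and of the tree's matrix vocabulary (`IsRowStochastic`, `IsIrreducible`).
Everything is PROVED (0 named facts).

* `IsHarmonicExtension P B hB h` — `h = h_B` on `B` and `h(x) = Σ_y P(x,y) h(y)` (eq. (9.2)) at every
  `x ∉ B` [cite: LevinPeres2017, §9.2 eq. (9.2), Prop. 9.1];
* `IsHarmonicExtension.le_of_forall_mem` / `.ge_of_forall_mem` — MAXIMUM PRINCIPLE: on an
  irreducible chain a harmonic extension lies between the bounds of its boundary values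
  ("`g ≤ 0` … applying this argument to `−g` shows that `min g ≥ 0`") [cite: LevinPeres2017, §9.2,
  proof of Prop. 9.1 (uniqueness)];
* **PROPOSITION 9.1, uniqueness** `LevinPeres2017_prop_9_1_unique` — two harmonic extensions of the
  same boundary data on a nonempty `B` coincide [cite: LevinPeres2017, §9.2 Prop. 9.1];
* **PROPOSITION 9.1, existence** `LevinPeres2017_prop_9_1_exists` — a harmonic extension exists
  [cite: LevinPeres2017, §9.2 Prop. 9.1].  DECLARED DEVIATION (no path space in this tree): the book's
  extension is `h(x) = E_x h_B(X_{τ_B})` (eqs. (9.3)–(9.4)); here existence is the rank–nullity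
  consequence of uniqueness for the linear map `u ↦ (u|_B ; u − Pu off B)` on the finite-dimensional
  space `X → ℝ`, exactly as for the hitting-time system in `RandomTargetLemma.lean`.

Context (cell pub-lqcd): harmonic extensions are the voltages of Chapter 9's network language for
reversible chains (escape probabilities, commute times); Prop. 9.1 is the well-posedness statement
every such computation rests on, for ALL irreducible chains (reversibility not assumed, as the book
stresses).
-/

namespace Literature.Probability.MarkovChains

open Finset Matrix

variable {X : Type*} [Fintype X] [DecidableEq X] {P : Matrix X X ℝ}

/-- `h` is the HARMONIC EXTENSION of the boundary data `h_B` (given as a function on `X`, read on `B`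
only): `h(x) = h_B(x)` for `x ∈ B` and `h` is harmonic for `P` (eq. (9.2): `h(x) = Σ_y P(x,y) h(y)`)
at every `x ∈ X ∖ B`. [cite: LevinPeres2017, §9.2 eq. (9.2) and Prop. 9.1] -/
def IsHarmonicExtension (P : Matrix X X ℝ) (B : Set X) (hB h : X → ℝ) : Prop :=
  (∀ x ∈ B, h x = hB x) ∧ ∀ x, x ∉ B → h x = ∑ y, P x y * h y

namespace IsHarmonicExtension

variable {B : Set X} {hB h : X → ℝ}

omit [DecidableEq X] in
/-- Boundary values. [cite: LevinPeres2017, §9.2 Prop. 9.1 ("`h(x) = h_B(x)` for all `x ∈ B`")] -/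
theorem eq_on (hh : IsHarmonicExtension P B hB h) {x : X} (hx : x ∈ B) : h x = hB x := hh.1 x hx

omit [DecidableEq X] in
/-- Harmonicity off `B`. [cite: LevinPeres2017, §9.2 eq. (9.2)] -/
theorem harmonic (hh : IsHarmonicExtension P B hB h) {x : X} (hx : x ∉ B) :
    h x = ∑ y, P x y * h y := hh.2 x hx

/-- MAXIMUM PRINCIPLE, lower half: if `m ≤ h_B` on a nonempty `B` then `m ≤ h` everywhere
(irreducible chain). [cite: LevinPeres2017, §9.2, proof of Prop. 9.1 ("applying this argument to
`−g` shows that `min g ≥ 0`")] -/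
theorem ge_of_forall_mem (hP : IsRowStochastic P) (hirr : IsIrreducible P)
    (hh : IsHarmonicExtension P B hB h) {x : X} (hxB : x ∈ B) {m : ℝ} (hm : ∀ b ∈ B, m ≤ hB b)
    (a : X) : m ≤ h a :=
  harmonicOff_ge_of_forall_mem hP hirr hxB hh.2 (fun b hb => by rw [hh.eq_on hb]; exact hm b hb) a

/-- MAXIMUM PRINCIPLE, upper half: if `h_B ≤ M` on a nonempty `B` then `h ≤ M` everywhere
(irreducible chain). [cite: LevinPeres2017, §9.2, proof of Prop. 9.1 ("We first show that
`g ≤ 0`")] -/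
theorem le_of_forall_mem (hP : IsRowStochastic P) (hirr : IsIrreducible P)
    (hh : IsHarmonicExtension P B hB h) {x : X} (hxB : x ∈ B) {M : ℝ} (hM : ∀ b ∈ B, hB b ≤ M)
    (a : X) : h a ≤ M := by
  have hneg : IsHarmonicExtension P B (fun y => -hB y) (fun y => -h y) := by
    refine ⟨fun y hy => ?_, fun y hy => ?_⟩
    · show -h y = -hB y
      rw [hh.eq_on hy]
    · show -h y = ∑ z, P y z * -h z
      rw [hh.harmonic hy, ← sum_neg_distrib]
      exact sum_congr rfl fun z _ => by ring
  have := hneg.ge_of_forall_mem hP hirr hxB (m := -M) (fun b hb => neg_le_neg (hM b hb)) a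
  linarith

end IsHarmonicExtension

/-- **PROPOSITION 9.1 (uniqueness).**  On an irreducible chain, the harmonic extension of boundary
data on a nonempty set `B` is unique ("`g` … harmonic on `X ∖ B` and … `g(x) = 0` for all `x ∈ B` …
`g ≤ 0` … `min g ≥ 0`"). [cite: LevinPeres2017, §9.2 Prop. 9.1; Remark 9.2] -/
theorem LevinPeres2017_prop_9_1_unique (hP : IsRowStochastic P) (hirr : IsIrreducible P)
    {B : Set X} {x : X} (hxB : x ∈ B) {hB h h' : X → ℝ} (hh : IsHarmonicExtension P B hB h)
    (hh' : IsHarmonicExtension P B hB h') : h = h' := by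
  -- `g = h − h'` is the harmonic extension of the zero boundary data
  have hg : IsHarmonicExtension P B (fun _ => 0) (fun y => h y - h' y) := by
    refine ⟨fun y hy => ?_, fun y hy => ?_⟩
    · show h y - h' y = 0
      rw [hh.eq_on hy, hh'.eq_on hy, sub_self]
    · show h y - h' y = ∑ z, P y z * (h z - h' z)
      rw [hh.harmonic hy, hh'.harmonic hy, ← sum_sub_distrib]
      exact sum_congr rfl fun z _ => by ring
  funext a
  have h1 := hg.ge_of_forall_mem hP hirr hxB (m := 0) (fun _ _ => le_rfl) a
  have h2 := hg.le_of_forall_mem hP hirr hxB (M := 0) (fun _ _ => le_rfl) a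
  linarith

/-- **PROPOSITION 9.1 (existence).**  On an irreducible chain every boundary datum on a nonempty `B`
has a harmonic extension (hence exactly one). [cite: LevinPeres2017, §9.2 Prop. 9.1]  DECLARED
DEVIATION: the book exhibits `h(x) = E_x h_B(X_{τ_B})` via (9.3)–(9.4); here the linear map
`u ↦ (a ↦ u(a) if a ∈ B, else u(a) − (Pu)(a))` of `X → ℝ` is injective by the uniqueness part,
hence surjective (rank–nullity). -/
theorem LevinPeres2017_prop_9_1_exists (hP : IsRowStochastic P) (hirr : IsIrreducible P)
    {B : Set X} {x : X} (hxB : x ∈ B) (hB : X → ℝ) :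
    ∃ h : X → ℝ, IsHarmonicExtension P B hB h := by
  classical
  let L : (X → ℝ) →ₗ[ℝ] (X → ℝ) :=
    { toFun := fun u a => if a ∈ B then u a else u a - ∑ y, P a y * u y
      map_add' := by
        intro u v
        funext a
        by_cases ha : a ∈ B
        · simp [ha]
        · simp only [ha, if_false, Pi.add_apply]
          rw [show (∑ y, P a y * (u y + v y)) = ∑ y, P a y * u y + ∑ y, P a y * v y by
            rw [← sum_add_distrib]; exact sum_congr rfl fun y _ => by ring]
          ring
      map_smul' := by
        intro c u
        funext a
        by_cases ha : a ∈ B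
        · simp [ha]
        · simp only [ha, if_false, Pi.smul_apply, smul_eq_mul, RingHom.id_apply]
          rw [show (∑ y, P a y * (c * u y)) = c * ∑ y, P a y * u y by
            rw [mul_sum]; exact sum_congr rfl fun y _ => by ring]
          ring }
  have hLapp : ∀ (u : X → ℝ) a, L u a = if a ∈ B then u a else u a - ∑ y, P a y * u y :=
    fun u a => rfl
  have hinj : Function.Injective L := by
    intro u v huv
    -- `u − v` is the harmonic extension of the zero data, hence zero
    have hext : IsHarmonicExtension P B (fun _ => 0) (fun a => u a - v a) := by
      refine ⟨fun a ha => ?_, fun a ha => ?_⟩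
      · have := congrFun huv a
        rw [hLapp, hLapp, if_pos ha, if_pos ha] at this
        show u a - v a = 0
        linarith
      · have := congrFun huv a
        rw [hLapp, hLapp, if_neg ha, if_neg ha] at this
        show u a - v a = ∑ y, P a y * (u y - v y)
        have hsplit : ∑ y, P a y * (u y - v y) = ∑ y, P a y * u y - ∑ y, P a y * v y := by
          rw [← sum_sub_distrib]; exact sum_congr rfl fun y _ => by ring
        rw [hsplit]
        linarith
    have hzero : IsHarmonicExtension P B (fun _ => (0 : ℝ)) (fun _ => 0) :=
      ⟨fun _ _ => rfl, fun a _ => by simp⟩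
    have hw := LevinPeres2017_prop_9_1_unique hP hirr hxB hext hzero
    funext a
    have : u a - v a = 0 := congrFun hw a
    linarith
  have hsurj : Function.Surjective L := LinearMap.surjective_of_injective hinj
  obtain ⟨u, hu⟩ := hsurj fun a => if a ∈ B then hB a else 0
  refine ⟨u, fun a ha => ?_, fun a ha => ?_⟩
  · have := congrFun hu a
    rw [hLapp, if_pos ha] at this
    simpa [ha] using this
  · have := congrFun hu a
    rw [hLapp, if_neg ha] at this
    simp only [ha, if_false] at this
    linarith

end Literature.Probability.MarkovChains
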